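import Summits.QuantumFields.BalabanUV.T4Continuum.Support.NE3TentBump
import Summits.QuantumFields.BalabanUV.T4Continuum.Support.NE3ProjectedLandauProjection
import HarnessLib

/-!
# T⁴ programme, node NE3 — row E-MLw-(w4)-P, curved route H♮, row K5a (flat half of K5), file 2: THE BLOCK-MEAN-EXACT INTERPOLANT —
# corner values AND block means prescribed by the same coarse datum, Dirichlet energy `O(M^{d−2})·Σ|dm|²`

NE3 (node U1b) formalisation swarm, leaf seat `b2b-balaban-t4-ne3-formalise-leaf-01` (gen 5); row **K5** of ruling ρ-g22-2
(`D-ne3p1-g22-1.md` §2 S7 «covariant block-mean-exact interpolant», §4 K5 → leaf-01-g5), flat half K5a, INTENT journal ≈16:57Z.  Over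
H3 `NE3CoarseInterpolant` (the multilinear interpolant, `C_I = 2^{d−1}`) and file 1 `NE3TentBump` (the bump that fixes block means) BY NAME;
the owner's flat competitor of F-ne3p1-g21-1 §2(c) («I = any block-mean-exact interpolant of coarse data with `I(m)(corner z) = m(z)` and
`‖dI(m)‖² ≤ C_I·σ^{d−2}Σ|dm|²`») made explicit.

CONTENT ([folklore]; 0 sorry; DATA defs `bmeCoef`, `bmeInterp`), `𝔸` a real normed ring-module, `M ≥ 2`, `N ≥ 1`, `m` `N`-periodic:
§1 local interpolation error in the square: `normSq_interp_sub_le` — `‖interp M S m y − m (blk M y)‖² ≤ Σ_{T ⊆ S} ‖m (blk y + indic T) − m (blk y)‖²`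
   (H3's local convexity applied to `m − m z`); cube-vertex increments against coarse differences:
   `sum_normSq_vertex_sub_le` — `Σ_{z∈periodBox N} ‖m (z + indic T) − m z‖² ≤ 2^{|T|}·|T|·Σ_z Σ_α ‖dPot m z α‖²`;
§2 `bmeCoef M m z := (tentSum d M)⁻¹ • Σ_{v∈[0,M)^d} (m z − interp M univ m (M•z + v))` and
   **`bmeInterp M m := interp M univ m + bump M (bmeCoef M m)`**: `bmeInterp_corner` (`= m z` at `M•z`, `d ≥ 1`), `bmeInterp_add_period`,
   **`sum_block_bmeInterp`** (`Σ_{v∈[0,M)^d} bmeInterp M m (M•z + v) = (M:ℝ)^d • m z` — EXACT block means);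
§3 **`sum_normSq_bmeCoef_le`** (`Σ_{z∈periodBox N} ‖bmeCoef M m z‖² ≤ d·256^d·Σ_z Σ_α ‖dPot m z α‖²`) and the energy bound
   **`sum_normSq_dPot_bmeInterp_le`**: `Σ_{y∈periodBox (M·N)} Σ_α ‖dPot (bmeInterp M m) y α‖² ≤ (2^{d+1} + 2·d²·256^d)·(M^d∕M²)·Σ_z Σ_α ‖dPot m z α‖²`
   — crude and honest (`C_bme(4) ≈ 1.4·10^11`), `k`-free, `N`-free, the advertised `M^{d−2}` scaling.

HONEST FRAMING.  Pure lattice calculus; nothing about Bałaban's minimisers; (P♮), (ML_w) at W ≠ 1, T-E_w and **NE3 are NOT proved**;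
spine PROVED 0∕9; finite T⁴ rung (B)+1 — NOT infinite volume, NOT mass gap, NOT `BetaPertH`, NOT Clay.  PLACEMENT:
`Summits/QuantumFields/BalabanUV/`.  HONEST DEPENDENCY (cell page 1): continuum YM on T⁴ ⇐ BetaPertH ∧ nine spine estimates (0/9 proved);
BetaPertH ⇐ (D1) ∧ (D4) ∧ CAP+tail; G-an2-4 gates asym, D1 and NE2/3/4.
-/

set_option autoImplicit false

open scoped BigOperators
open Finset

namespace Summit.QuantumFields.BalabanUV.T4Continuum.NE3BlockMeanExactInterpolant

open Literature.MathematicalPhysics.QuantumFieldTheory.Balaban1983to89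
open B7Prop1Explicit
open T4AveragingDeficitWallBoundary (periodBox mem_periodBox card_periodBox sum_periodBox_shift)
open SmoothRefineBlocks (blk res blk_res_smul blk_res_add_period)
open SmoothRefineInterp (indic indic_insert interpCore interpCore_sub interpCore_const wt wt_nonneg wt_le_one interp
  interp_of_res_eq_zero)
open NE3BlockLineAverage (sum_periodBox_blocks)
open NE3TangentNoGoWords (dPot)
open NE3CoarseInterpolant (interp_corner interp_add_period normSq_interpCore_le sum_normSq_dPot_interp_le blk_block)
open NE3TentBump (tentSum tentSum_pos le_tentSum bump bump_corner sum_block_bump bump_add_period sum_normSq_dPot_bump_le)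
open NE3ProjectedLandauProjection (periodic_block_shift)

noncomputable section

variable {d : ℕ}
variable {𝔸 : Type*} [NormedRing 𝔸] [NormedSpace ℝ 𝔸]

/-! ## §1 Local interpolation error and cube-vertex increments -/

/-- **LOCAL INTERPOLATION ERROR**: `‖interp M S m y − m (blk M y)‖² ≤ Σ_{T ⊆ S} ‖m (blk M y + indic T) − m (blk M y)‖²` (`M ≥ 1`). [folklore] -/
theorem normSq_interp_sub_le {M : ℕ} (hM : 1 ≤ M) (S : Finset (Fin d)) (m : Site d → 𝔸) (y : Site d) :
    ‖interp M S m y - m (blk M y)‖ ^ 2 ≤ ∑ T ∈ S.powerset, ‖m (blk M y + indic T) - m (blk M y)‖ ^ 2 := by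
  have h := normSq_interpCore_le S (wt_nonneg hM y) (wt_le_one hM y) (fun x => m x - m (blk M y)) (blk M y)
  rw [interpCore_sub, interpCore_const] at h
  exact h

omit [NormedSpace ℝ 𝔸] in
/-- **CUBE-VERTEX INCREMENTS AGAINST COARSE DIFFERENCES** (periodic sums): for `N ≥ 1` and `N`-periodic `m`,
`Σ_{z∈periodBox N} ‖m (z + indic T) − m z‖² ≤ 2^{|T|}·|T|·Σ_{z∈periodBox N} Σ_α ‖dPot m z α‖²` (induction on `T`, one unit step at a
time, shift-invariance of periodic sums). [folklore] -/
theorem sum_normSq_vertex_sub_le {N : ℕ} (hN : 1 ≤ N) {m : Site d → 𝔸}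
    (hm : ∀ (z : Site d) (τ : Fin d), m (z + (N : ℤ) • e τ) = m z) (T : Finset (Fin d)) :
    ∑ z ∈ periodBox (d := d) N, ‖m (z + indic T) - m z‖ ^ 2
      ≤ (2 : ℝ) ^ T.card * T.card * ∑ z ∈ periodBox (d := d) N, ∑ α : Fin d, ‖dPot m z α‖ ^ 2 := by
  set D : ℝ := ∑ z ∈ periodBox (d := d) N, ∑ α : Fin d, ‖dPot m z α‖ ^ 2 with hD
  have hD0 : 0 ≤ D := Finset.sum_nonneg fun _ _ => Finset.sum_nonneg fun _ _ => sq_nonneg _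
  induction T using Finset.induction_on with
  | empty => simp
  | insert i T hi ih =>
    rw [Finset.card_insert_of_notMem hi]
    -- one more unit step: `m(z + e_i + 1_T) − m z = [m(z + e_i + 1_T) − m(z + e_i)] + [m(z + e_i) − m z]`
    have hpt : ∀ z : Site d, ‖m (z + indic (insert i T)) - m z‖ ^ 2
        ≤ 2 * ‖m ((z + e i) + indic T) - m (z + e i)‖ ^ 2 + 2 * ‖dPot m z i‖ ^ 2 := by
      intro z
      rw [indic_insert hi, ← add_assoc]
      have hsplit : m (z + e i + indic T) - m z = (m (z + e i + indic T) - m (z + e i)) + dPot m z i := by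
        simp only [dPot]; abel
      rw [hsplit]
      have h := norm_add_le (m (z + e i + indic T) - m (z + e i)) (dPot m z i)
      nlinarith [sq_nonneg (‖m (z + e i + indic T) - m (z + e i)‖ - ‖dPot m z i‖), norm_nonneg (m (z + e i + indic T) - m (z + e i)),
        norm_nonneg (dPot m z i), norm_nonneg (m (z + e i + indic T) - m (z + e i) + dPot m z i)]
    have hshift : ∑ z ∈ periodBox (d := d) N, ‖m ((z + e i) + indic T) - m (z + e i)‖ ^ 2
        = ∑ z ∈ periodBox (d := d) N, ‖m (z + indic T) - m z‖ ^ 2 :=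
      sum_periodBox_shift N hN (g := fun z => ‖m (z + indic T) - m z‖ ^ 2) (fun x κ => by
        show ‖m (x + (N : ℤ) • e κ + indic T) - m (x + (N : ℤ) • e κ)‖ ^ 2 = ‖m (x + indic T) - m x‖ ^ 2
        rw [add_right_comm, hm, hm]) (e i)
    have hDi : ∑ z ∈ periodBox (d := d) N, ‖dPot m z i‖ ^ 2 ≤ D :=
      Finset.sum_le_sum fun z _ => Finset.single_le_sum (fun α _ => sq_nonneg (‖dPot m z α‖)) (Finset.mem_univ i)
    calc ∑ z ∈ periodBox (d := d) N, ‖m (z + indic (insert i T)) - m z‖ ^ 2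
        ≤ ∑ z ∈ periodBox (d := d) N, (2 * ‖m ((z + e i) + indic T) - m (z + e i)‖ ^ 2 + 2 * ‖dPot m z i‖ ^ 2) :=
          Finset.sum_le_sum fun z _ => hpt z
      _ = 2 * ∑ z ∈ periodBox (d := d) N, ‖m (z + indic T) - m z‖ ^ 2 + 2 * ∑ z ∈ periodBox (d := d) N, ‖dPot m z i‖ ^ 2 := by
          rw [Finset.sum_add_distrib, ← Finset.mul_sum, ← Finset.mul_sum, hshift]
      _ ≤ 2 * ((2 : ℝ) ^ T.card * T.card * D) + 2 * D := by gcongr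
      _ ≤ (2 : ℝ) ^ (T.card + 1) * ((T.card + 1 : ℕ) : ℝ) * D := by
          have h2 : (1 : ℝ) ≤ (2 : ℝ) ^ T.card := one_le_pow₀ (by norm_num)
          have h3 : 0 ≤ D * ((2 : ℝ) ^ T.card - 1) := mul_nonneg hD0 (sub_nonneg.mpr h2)
          rw [pow_succ]; push_cast
          nlinarith [h3]

/-! ## §2 The block-mean-exact interpolant -/

/-- THE MEAN-CORRECTION COEFFICIENT of block `z`: `(tentSum d M)⁻¹ • Σ_{v∈[0,M)^d} (m z − interp M univ m (M•z + v))`. [folklore] -/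
def bmeCoef (M : ℕ) (m : Site d → 𝔸) (z : Site d) : 𝔸 :=
  (tentSum d M)⁻¹ • ∑ v ∈ periodBox (d := d) M, (m z - interp M Finset.univ m ((M : ℤ) • z + v))

/-- **THE BLOCK-MEAN-EXACT INTERPOLANT**: the multilinear interpolant plus the tent bump carrying the mean correction. [folklore] -/
def bmeInterp (M : ℕ) (m : Site d → 𝔸) (y : Site d) : 𝔸 := interp M Finset.univ m y + bump M (bmeCoef M m) y

/-- **CORNER VALUES**: `bmeInterp M m (M•z) = m z` (`M ≥ 1`, `d ≥ 1`). [folklore] -/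
theorem bmeInterp_corner {M : ℕ} (hM : 1 ≤ M) (hd : 0 < d) (m : Site d → 𝔸) (z : Site d) :
    bmeInterp M m ((M : ℤ) • z) = m z := by
  unfold bmeInterp
  rw [interp_corner hM Finset.univ m z, bump_corner hM hd, add_zero]

/-- The mean-correction coefficient of an `N`-periodic datum is `N`-periodic. [folklore] -/
theorem bmeCoef_add_period {M : ℕ} (hM : 1 ≤ M) {N : ℕ} {m : Site d → 𝔸}
    (hm : ∀ (z : Site d) (τ : Fin d), m (z + (N : ℤ) • e τ) = m z) (z : Site d) (τ : Fin d) :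
    bmeCoef M m (z + (N : ℤ) • e τ) = bmeCoef M m z := by
  unfold bmeCoef
  congr 1
  refine Finset.sum_congr rfl fun v _ => ?_
  rw [hm, periodic_block_shift (f := interp M Finset.univ m) (fun x τ' => interp_add_period hM Finset.univ hm x τ') z (e τ) v]

/-- **PERIODICITY**: `bmeInterp M m` is `(M·N)`-periodic for `N`-periodic `m`. [folklore] -/
theorem bmeInterp_add_period {M : ℕ} (hM : 1 ≤ M) {N : ℕ} {m : Site d → 𝔸}
    (hm : ∀ (z : Site d) (τ : Fin d), m (z + (N : ℤ) • e τ) = m z) (y : Site d) (τ : Fin d) :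
    bmeInterp M m (y + ((M * N : ℕ) : ℤ) • e τ) = bmeInterp M m y := by
  unfold bmeInterp
  rw [interp_add_period hM Finset.univ hm y τ, bump_add_period hM (bmeCoef_add_period hM hm) y τ]

/-- **EXACT BLOCK MEANS**: `Σ_{v∈[0,M)^d} bmeInterp M m (M•z + v) = (M:ℝ)^d • m z` (`M ≥ 2`). [folklore] -/
theorem sum_block_bmeInterp {M : ℕ} (hM : 2 ≤ M) (m : Site d → 𝔸) (z : Site d) :
    ∑ v ∈ periodBox (d := d) M, bmeInterp M m ((M : ℤ) • z + v) = ((M : ℝ) ^ d) • m z := by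
  have hM1 : 1 ≤ M := by omega
  have hT : tentSum d M ≠ 0 := (tentSum_pos hM d).ne'
  unfold bmeInterp
  rw [Finset.sum_add_distrib, sum_block_bump hM1, bmeCoef, smul_smul, mul_inv_cancel₀ hT, one_smul, Finset.sum_sub_distrib,
    Finset.sum_const, card_periodBox, ← Nat.cast_smul_eq_nsmul ℝ]
  push_cast
  abel

/-! ## §3 The cost of the mean correction and the energy bound -/

omit [NormedSpace ℝ 𝔸] in
/-- `(Σ_{v∈s} a_v)² ≤ |s|·Σ a_v²` for norms of a vector sum: `‖Σ_{v∈s} x_v‖² ≤ |s|·Σ_{v∈s} ‖x_v‖²`. [folklore] -/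
theorem normSq_sum_le_card_mul {ι : Type*} (s : Finset ι) (x : ι → 𝔸) :
    ‖∑ v ∈ s, x v‖ ^ 2 ≤ s.card * ∑ v ∈ s, ‖x v‖ ^ 2 := by
  calc ‖∑ v ∈ s, x v‖ ^ 2 ≤ (∑ v ∈ s, ‖x v‖) ^ 2 := pow_le_pow_left₀ (norm_nonneg _) (norm_sum_le _ _) 2
    _ ≤ s.card * ∑ v ∈ s, ‖x v‖ ^ 2 := sq_sum_le_card_mul_sum_sq

/-- **THE COST OF THE MEAN CORRECTION**: `Σ_{z∈periodBox N} ‖bmeCoef M m z‖² ≤ d·256^d·Σ_{z∈periodBox N} Σ_α ‖dPot m z α‖²`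
(`M ≥ 2`, `N ≥ 1`, `m` `N`-periodic; `tentSum ≥ (M∕8)^d`, Cauchy–Schwarz over the block, §1). [folklore] -/
theorem sum_normSq_bmeCoef_le {M N : ℕ} (hM : 2 ≤ M) (hN : 1 ≤ N) {m : Site d → 𝔸}
    (hm : ∀ (z : Site d) (τ : Fin d), m (z + (N : ℤ) • e τ) = m z) :
    ∑ z ∈ periodBox (d := d) N, ‖bmeCoef M m z‖ ^ 2
      ≤ (d : ℝ) * (256 : ℝ) ^ d * ∑ z ∈ periodBox (d := d) N, ∑ α : Fin d, ‖dPot m z α‖ ^ 2 := by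
  have hM1 : 1 ≤ M := by omega
  have hM0 : (0 : ℝ) < M := by exact_mod_cast (by omega : 0 < M)
  set D : ℝ := ∑ z ∈ periodBox (d := d) N, ∑ α : Fin d, ‖dPot m z α‖ ^ 2 with hD
  have hD0 : 0 ≤ D := Finset.sum_nonneg fun _ _ => Finset.sum_nonneg fun _ _ => sq_nonneg _
  have hTS := tentSum_pos hM d
  have hTSle := le_tentSum hM d
  -- pointwise: `‖c_z‖² ≤ tentSum⁻²·M^d·Σ_v Σ_T ‖m(z + 1_T) − m z‖²`
  have hpt : ∀ z : Site d, ‖bmeCoef M m z‖ ^ 2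
      ≤ (tentSum d M)⁻¹ ^ 2 * ((M : ℝ) ^ d * ∑ v ∈ periodBox (d := d) M,
          ∑ T ∈ (Finset.univ : Finset (Fin d)).powerset, ‖m (z + indic T) - m z‖ ^ 2) := by
    intro z
    unfold bmeCoef
    rw [norm_smul, mul_pow, Real.norm_of_nonneg (inv_nonneg.mpr hTS.le)]
    refine mul_le_mul_of_nonneg_left ?_ (by positivity)
    have h1 := normSq_sum_le_card_mul (periodBox (d := d) M) (fun v => m z - interp M Finset.univ m ((M : ℤ) • z + v))
    rw [card_periodBox] at h1
    push_cast at h1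
    refine h1.trans (mul_le_mul_of_nonneg_left (Finset.sum_le_sum fun v hv => ?_) (by positivity))
    rw [norm_sub_rev]
    have h2 := normSq_interp_sub_le hM1 Finset.univ m ((M : ℤ) • z + v)
    rw [blk_block hM1 z hv] at h2
    exact h2
  -- sum over blocks; the `v`-sum is constant (`M^d` copies); the `T`-sums are bounded by §1
  have hT : ∀ T ∈ (Finset.univ : Finset (Fin d)).powerset,
      ∑ z ∈ periodBox (d := d) N, ‖m (z + indic T) - m z‖ ^ 2 ≤ (2 : ℝ) ^ d * d * D := by
    intro T hT
    have hcard : T.card ≤ d := by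
      have := Finset.card_le_card (Finset.mem_powerset.1 hT); simpa using this
    calc ∑ z ∈ periodBox (d := d) N, ‖m (z + indic T) - m z‖ ^ 2 ≤ (2 : ℝ) ^ T.card * T.card * D :=
          sum_normSq_vertex_sub_le hN hm T
      _ ≤ (2 : ℝ) ^ d * d * D := by
          have h1 : (2 : ℝ) ^ T.card ≤ (2 : ℝ) ^ d := pow_le_pow_right₀ (by norm_num) hcard
          have h2 : (T.card : ℝ) ≤ d := by exact_mod_cast hcard
          exact mul_le_mul (mul_le_mul h1 h2 (by positivity) (by positivity)) le_rfl hD0 (by positivity)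
  have hpow : ((Finset.univ : Finset (Fin d)).powerset.card : ℝ) = (2 : ℝ) ^ d := by
    rw [Finset.card_powerset, Finset.card_univ, Fintype.card_fin]; push_cast; ring
  calc ∑ z ∈ periodBox (d := d) N, ‖bmeCoef M m z‖ ^ 2
      ≤ ∑ z ∈ periodBox (d := d) N, (tentSum d M)⁻¹ ^ 2 * ((M : ℝ) ^ d * ∑ v ∈ periodBox (d := d) M,
          ∑ T ∈ (Finset.univ : Finset (Fin d)).powerset, ‖m (z + indic T) - m z‖ ^ 2) := Finset.sum_le_sum fun z _ => hpt z
    _ = (tentSum d M)⁻¹ ^ 2 * ((M : ℝ) ^ d * ((M : ℝ) ^ d *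
          ∑ T ∈ (Finset.univ : Finset (Fin d)).powerset, ∑ z ∈ periodBox (d := d) N, ‖m (z + indic T) - m z‖ ^ 2)) := by
        rw [← Finset.mul_sum, ← Finset.mul_sum]
        congr 2
        simp_rw [Finset.sum_const, card_periodBox, nsmul_eq_mul, Nat.cast_pow]
        rw [← Finset.mul_sum, Finset.sum_comm]
    _ ≤ (tentSum d M)⁻¹ ^ 2 * ((M : ℝ) ^ d * ((M : ℝ) ^ d *
          ∑ T ∈ (Finset.univ : Finset (Fin d)).powerset, ((2 : ℝ) ^ d * d * D))) := by
        gcongr with T hT'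
        exact hT T hT'
    _ = ((M : ℝ) ^ d * (tentSum d M)⁻¹) ^ 2 * ((2 : ℝ) ^ d * ((2 : ℝ) ^ d * d * D)) := by
        rw [Finset.sum_const, nsmul_eq_mul, hpow]; ring
    _ ≤ ((8 : ℝ) ^ d) ^ 2 * ((2 : ℝ) ^ d * ((2 : ℝ) ^ d * d * D)) := by
        have hq : (M : ℝ) ^ d * (tentSum d M)⁻¹ ≤ (8 : ℝ) ^ d := by
          rw [← div_eq_mul_inv, div_le_iff₀ hTS]
          calc (M : ℝ) ^ d = (8 : ℝ) ^ d * ((M : ℝ) / 8) ^ d := by rw [← mul_pow]; congr 1; ring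
            _ ≤ (8 : ℝ) ^ d * tentSum d M := mul_le_mul_of_nonneg_left hTSle (by positivity)
        have hq0 : 0 ≤ (M : ℝ) ^ d * (tentSum d M)⁻¹ := by positivity
        gcongr
    _ = (d : ℝ) * (256 : ℝ) ^ d * D := by
        have h256 : ((8 : ℝ) ^ d) ^ 2 * ((2 : ℝ) ^ d * (2 : ℝ) ^ d) = (256 : ℝ) ^ d := by
          rw [sq, ← mul_pow, ← mul_pow, ← mul_pow]; norm_num
        rw [← h256]; ring

/-- **THE DIRICHLET ENERGY OF THE BLOCK-MEAN-EXACT INTERPOLANT** (`M ≥ 2`, `N ≥ 1`, `m` `N`-periodic):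
`Σ_{y∈periodBox (M·N)} Σ_α ‖dPot (bmeInterp M m) y α‖² ≤ (2^{d+1} + 2·d²·256^d)·(M^d∕M²)·Σ_{z∈periodBox N} Σ_α ‖dPot m z α‖²`. [folklore] -/
theorem sum_normSq_dPot_bmeInterp_le {M N : ℕ} (hM : 2 ≤ M) (hN : 1 ≤ N) {m : Site d → 𝔸}
    (hm : ∀ (z : Site d) (τ : Fin d), m (z + (N : ℤ) • e τ) = m z) :
    ∑ y ∈ periodBox (d := d) (M * N), ∑ α : Fin d, ‖dPot (bmeInterp M m) y α‖ ^ 2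
      ≤ ((2 : ℝ) ^ (d + 1) + 2 * (d : ℝ) ^ 2 * (256 : ℝ) ^ d) * ((M : ℝ) ^ d / (M : ℝ) ^ 2)
          * ∑ z ∈ periodBox (d := d) N, ∑ α : Fin d, ‖dPot m z α‖ ^ 2 := by
  have hM1 : 1 ≤ M := by omega
  have hM0 : (0 : ℝ) < M := by exact_mod_cast (by omega : 0 < M)
  set D : ℝ := ∑ z ∈ periodBox (d := d) N, ∑ α : Fin d, ‖dPot m z α‖ ^ 2 with hD
  have hD0 : 0 ≤ D := Finset.sum_nonneg fun _ _ => Finset.sum_nonneg fun _ _ => sq_nonneg _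
  -- split the coboundary: interpolant + bump
  have hpt : ∀ (y : Site d) (α : Fin d), ‖dPot (bmeInterp M m) y α‖ ^ 2
      ≤ 2 * ‖dPot (interp M Finset.univ m) y α‖ ^ 2 + 2 * ‖dPot (bump M (bmeCoef M m)) y α‖ ^ 2 := by
    intro y α
    have hsplit : dPot (bmeInterp M m) y α = dPot (interp M Finset.univ m) y α + dPot (bump M (bmeCoef M m)) y α := by
      simp only [dPot, bmeInterp]; abel
    rw [hsplit]
    have h := norm_add_le (dPot (interp M Finset.univ m) y α) (dPot (bump M (bmeCoef M m)) y α)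
    nlinarith [sq_nonneg (‖dPot (interp M Finset.univ m) y α‖ - ‖dPot (bump M (bmeCoef M m)) y α‖),
      norm_nonneg (dPot (interp M Finset.univ m) y α), norm_nonneg (dPot (bump M (bmeCoef M m)) y α),
      norm_nonneg (dPot (interp M Finset.univ m) y α + dPot (bump M (bmeCoef M m)) y α)]
  have hI := sum_normSq_dPot_interp_le (𝔸 := 𝔸) hM1 hN hm
  have hB := sum_normSq_dPot_bump_le (𝔸 := 𝔸) hM1 N (bmeCoef M m)
  have hC := sum_normSq_bmeCoef_le hM hN hm
  have hd1 : (2 : ℝ) ^ (d - 1) ≤ (2 : ℝ) ^ d := pow_le_pow_right₀ (by norm_num) (Nat.sub_le d 1)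
  calc ∑ y ∈ periodBox (d := d) (M * N), ∑ α : Fin d, ‖dPot (bmeInterp M m) y α‖ ^ 2
      ≤ ∑ y ∈ periodBox (d := d) (M * N), ∑ α : Fin d,
          (2 * ‖dPot (interp M Finset.univ m) y α‖ ^ 2 + 2 * ‖dPot (bump M (bmeCoef M m)) y α‖ ^ 2) :=
        Finset.sum_le_sum fun y _ => Finset.sum_le_sum fun α _ => hpt y α
    _ = 2 * ∑ y ∈ periodBox (d := d) (M * N), ∑ α : Fin d, ‖dPot (interp M Finset.univ m) y α‖ ^ 2
          + 2 * ∑ y ∈ periodBox (d := d) (M * N), ∑ α : Fin d, ‖dPot (bump M (bmeCoef M m)) y α‖ ^ 2 := by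
        simp only [Finset.sum_add_distrib, Finset.mul_sum]
    _ ≤ 2 * ((2 : ℝ) ^ (d - 1) * ((M : ℝ) ^ d / (M : ℝ) ^ 2) * D)
          + 2 * ((d : ℝ) * ((M : ℝ) ^ d / (M : ℝ) ^ 2) * ∑ z ∈ periodBox (d := d) N, ‖bmeCoef M m z‖ ^ 2) := by gcongr
    _ ≤ 2 * ((2 : ℝ) ^ d * ((M : ℝ) ^ d / (M : ℝ) ^ 2) * D)
          + 2 * ((d : ℝ) * ((M : ℝ) ^ d / (M : ℝ) ^ 2) * ((d : ℝ) * (256 : ℝ) ^ d * D)) := by gcongr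
    _ = ((2 : ℝ) ^ (d + 1) + 2 * (d : ℝ) ^ 2 * (256 : ℝ) ^ d) * ((M : ℝ) ^ d / (M : ℝ) ^ 2) * D := by ring

end

end Summit.QuantumFields.BalabanUV.T4Continuum.NE3BlockMeanExactInterpolant
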